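import Literature.Computability.AlgebraicComplexity.GKKP11Thm2Proofs
import HarnessLib

/-!
# GKKP 2011, Theorem 3: a formula of GREEN size `e` is a symmetric determinant of size `2e + 3`
— proof of the named fact `GKKP2011_thm3`

Topic `Literature/Computability/AlgebraicComplexity`; second proofs file for
`GKKP11SymmetricRepresentations.lean` (B. Grenet, E. L. Kaltofen, P. Koiran, N. Portier,
arXiv:1007.3804, held text `paper:arxiv-1007.3804`), **Theorem 3** (§2.2, p0010): "For every
formula `φ` of green size `e` there is a square matrix `A` of dimensions `2e+3` whose entries are
inputs of the formula and elements of `{0,1,-1,1/2}` such that `φ = det A`" (symmetric), typed —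
with the entry-set erratum recorded in the statement file — with entries inputs of `φ` or constants
of `k`. Printed proof (p0010): "It is sufficient to show how to have the constants for free in the
construction of Lemma 3 … there exists a constant `c₀` such that `c₀ · Σ_P (-1)^{|P|/2+1} w(P) = φ`.
… Let `φ = cψ` … Then `G`, `c c₀` is associated to `φ`. … Let `φ = φ₁ + φ₂` … adding a new vertex
`u`, an edge `t₂u` with weight `1` and an edge `ut₁` with weight `-c₂/c₁`, and the associated
constant is `c₁` … the edges `tc` of weight `c₀/2` and `cs` of weight `(-1)^{|G|/2-1}`."

This file runs that induction on top of the matrix calculus of `GKKP11Thm2Proofs.lean`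
(`GKKP2011.Thm2.det_symD`, the signed symmetrised branching program with a direct edge):
`GKKP2011.Thm3.exists_signedABP` produces, for every formula `φ`, internal vertices `V` with
`|V| ≤ gsize(φ)`, the same kind of signed branching program (entries inputs of `φ` or constants of
`k`) and a constant `c₀` with `c₀ · (m − a·y) = φ`. Multiplication by a constant input is free
(`c₀ ↦ c c₀`); the product of non-constant formulas is the gadget of Thm. 2 (`c₀ = c₁c₂`); the sum
uses GKKP's vertex `u = t₂` with sink weight `−c₂/c₁` when `c₁ ≠ 0`, and when `c₁ = 0` (then
`φ₁ = 0`, a case the printed proof does not need to mention: e.g. `φ₁ = 0 × ψ`) simply the data of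
`φ₂`. The final matrix (`GKKP2011_thm3_holds`) pads `V` with isolated vertices up to `|V| = gsize(φ)`
(size exactly `2e+3` as printed) and takes `η = c₀/2` on `tc`, `ε = (-1)^e` on `cs`.

No new definitions, no new facts. Honest framing: typed literature, rung V1; nothing here bears on
`VP ≠ VNP`.

## References

* [GrenetEtAl2011] B. Grenet, E. L. Kaltofen, P. Koiran, N. Portier, Contemp. Math. 556 (2011)
  61–96, arXiv:1007.3804: §2.1 Def. 6 (green size, p0007), §2.2 Thm. 3 and its proof (p0010).
-/

noncomputable section

open Matrix MvPolynomial Finset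

namespace Literature.Computability.AlgebraicComplexity

namespace GKKP2011

namespace Thm3

variable {k : Type} [Field k] {σ : Type}

omit [Field k] in
/-- A constant input is a constant. [cite: GrenetEtAl2011, Def 6] -/
theorem exists_eq_const_of_isConstInput {φ : ArithExpr k σ} (h : φ.isConstInput = true) :
    ∃ c : k, φ = ArithExpr.const c := by
  cases φ with
  | var i => simp [ArithExpr.isConstInput] at h
  | const c => exact ⟨c, rfl⟩
  | add _ _ => simp [ArithExpr.isConstInput] at h
  | mul _ _ => simp [ArithExpr.isConstInput] at h

/-- **GKKP Lemma 3 with constants for free** (proof of Thm. 3, p0010): every formula `φ` has a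
signed branching program with a direct edge on at most `gsize(φ)` internal vertices, entries inputs
of `φ` or constants of `k`, unimodular transfer matrix, and a constant `c₀` with
`c₀ · (m − a·y) = φ` where `(D + N) y = b`. [cite: GrenetEtAl2011, Thm 3 (proof)] -/
theorem exists_signedABP (φ : ArithExpr k σ) :
    ∃ (V : Type) (_ : Fintype V) (_ : DecidableEq V) (d : V → MvPolynomial σ k)
      (N : Matrix V V (MvPolynomial σ k)) (a b : V → MvPolynomial σ k) (m : MvPolynomial σ k)
      (c₀ : k),
      Fintype.card V ≤ φ.greenSize ∧
      (∀ v, d v = 1 ∨ d v = -1) ∧ (∀ v, N v v = 0) ∧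
      (∀ u v, φ.IsInput (N u v) ∨ ∃ c : k, N u v = C c) ∧
      (∀ v, φ.IsInput (a v) ∨ ∃ c : k, a v = C c) ∧
      (∀ v, φ.IsInput (b v) ∨ ∃ c : k, b v = C c) ∧
      (φ.IsInput m ∨ ∃ c : k, m = C c) ∧
      ((diagonal d + N).det = 1 ∨ (diagonal d + N).det = -1) ∧
      ∃ y : V → MvPolynomial σ k, (diagonal d + N) *ᵥ y = b ∧ C c₀ * (m - a ⬝ᵥ y) = φ.eval := by
  induction φ with
  | var i =>
    refine ⟨PEmpty, inferInstance, inferInstance, PEmpty.elim, Matrix.of fun v => v.elim,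
      PEmpty.elim, PEmpty.elim, X i, 1, by simp, fun v => v.elim, fun v => v.elim,
      fun v => v.elim, fun v => v.elim, fun v => v.elim, Or.inl rfl, Or.inl det_isEmpty, ?_⟩
    exact ⟨PEmpty.elim, funext fun v => v.elim, by simp [dotProduct, ArithExpr.eval]⟩
  | const c =>
    refine ⟨PEmpty, inferInstance, inferInstance, PEmpty.elim, Matrix.of fun v => v.elim,
      PEmpty.elim, PEmpty.elim, C c, 1, by simp, fun v => v.elim, fun v => v.elim,
      fun v => v.elim, fun v => v.elim, fun v => v.elim, Or.inr ⟨c, rfl⟩, Or.inl det_isEmpty, ?_⟩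
    exact ⟨PEmpty.elim, funext fun v => v.elim, by simp [dotProduct, ArithExpr.eval]⟩
  | add φ₁ φ₂ ih₁ ih₂ =>
    obtain ⟨V₁, _, _, d₁, N₁, a₁, b₁, m₁, c₁, hc₁, hd₁, hN₁0, hN₁, ha₁, hb₁, hm₁, hdet₁, y₁, hy₁,
      hv₁⟩ := ih₁
    obtain ⟨V₂, _, _, d₂, N₂, a₂, b₂, m₂, c₂, hc₂, hd₂, hN₂0, hN₂, ha₂, hb₂, hm₂, hdet₂, y₂, hy₂,
      hv₂⟩ := ih₂
    by_cases hc10 : c₁ = 0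
    · -- `φ₁ = 0`: the data of `φ₂` represent `φ₁ + φ₂`
      have hφ₁ : φ₁.eval = 0 := by rw [← hv₁, hc10, C_0, zero_mul]
      refine ⟨V₂, inferInstance, inferInstance, d₂, N₂, a₂, b₂, m₂, c₂, ?_, hd₂, hN₂0,
        fun u v => (hN₂ u v).imp (fun h => Or.inr h) id, fun v => (ha₂ v).imp (fun h => Or.inr h) id,
        fun v => (hb₂ v).imp (fun h => Or.inr h) id, hm₂.imp (fun h => Or.inr h) id, hdet₂,
        y₂, hy₂, ?_⟩
      · simp only [ArithExpr.greenSize_add]; omega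
      · rw [hv₂, ArithExpr.eval, hφ₁, zero_add]
    · -- GKKP's sum with constants: new vertex `w = t₂`, sink arc of weight `-c₂/c₁`, constant `c₁`
      refine ⟨V₁ ⊕ (Unit ⊕ V₂), inferInstance, inferInstance,
        Sum.elim d₁ (Sum.elim (fun _ => 1) d₂),
        Matrix.fromBlocks N₁ 0 0 (Matrix.fromBlocks 0 0 (Matrix.of fun v _ => b₂ v) N₂),
        Sum.elim a₁ (Sum.elim (fun _ => m₂) a₂),
        Sum.elim b₁ (Sum.elim (fun _ => -C (c₂ / c₁)) 0), m₁, c₁, ?_, ?_, ?_, ?_, ?_, ?_, ?_, ?_, ?_⟩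
      · simp only [Fintype.card_sum, Fintype.card_unique, ArithExpr.greenSize_add]; omega
      · rintro (v | ⟨⟨⟩ | v⟩)
        · exact hd₁ v
        · exact Or.inl rfl
        · exact hd₂ v
      · rintro (v | ⟨⟨⟩ | v⟩)
        · exact hN₁0 v
        · rfl
        · exact hN₂0 v
      · rintro (u | ⟨⟨⟩ | u⟩) (v | ⟨⟨⟩ | v⟩)
        · exact (hN₁ u v).imp (fun h => Or.inl h) id
        · exact Or.inr ⟨0, C_0.symm⟩
        · exact Or.inr ⟨0, C_0.symm⟩
        · exact Or.inr ⟨0, C_0.symm⟩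
        · exact Or.inr ⟨0, C_0.symm⟩
        · exact Or.inr ⟨0, C_0.symm⟩
        · exact Or.inr ⟨0, C_0.symm⟩
        · exact (hb₂ u).imp (fun h => Or.inr h) id
        · exact (hN₂ u v).imp (fun h => Or.inr h) id
      · rintro (v | ⟨⟨⟩ | v⟩)
        · exact (ha₁ v).imp (fun h => Or.inl h) id
        · exact hm₂.imp (fun h => Or.inr h) id
        · exact (ha₂ v).imp (fun h => Or.inr h) id
      · rintro (v | ⟨⟨⟩ | v⟩)
        · exact (hb₁ v).imp (fun h => Or.inl h) id
        · exact Or.inr ⟨-(c₂ / c₁), show -C (c₂ / c₁) = C (-(c₂ / c₁)) by rw [C_neg]⟩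
        · exact Or.inr ⟨0, C_0.symm⟩
      · exact hm₁.imp (fun h => Or.inl h) id
      · have hD : diagonal (Sum.elim d₁ (Sum.elim (fun _ : Unit => (1 : MvPolynomial σ k)) d₂)) +
            Matrix.fromBlocks N₁ 0 0 (Matrix.fromBlocks 0 0 (Matrix.of fun v _ => b₂ v) N₂) =
            Matrix.fromBlocks (diagonal d₁ + N₁) 0 0
              (Matrix.fromBlocks (diagonal fun _ : Unit => (1 : MvPolynomial σ k)) 0
                (Matrix.of fun v _ => b₂ v) (diagonal d₂ + N₂)) := by
          rw [← fromBlocks_diagonal, ← fromBlocks_diagonal, fromBlocks_add, fromBlocks_add]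
          simp
        rw [hD, det_fromBlocks_zero₂₁, det_fromBlocks_zero₁₂, det_diagonal]
        simp only [Finset.univ_unique, Finset.prod_singleton, one_mul]
        rcases hdet₁ with h1 | h1 <;> rcases hdet₂ with h2 | h2 <;> rw [h1, h2] <;> simp
      · refine ⟨Sum.elim y₁ (Sum.elim (fun _ => -C (c₂ / c₁))
          ((C (c₂ / c₁) : MvPolynomial σ k) • y₂)), ?_, ?_⟩
        · have hD : diagonal (Sum.elim d₁ (Sum.elim (fun _ : Unit => (1 : MvPolynomial σ k)) d₂)) +
              Matrix.fromBlocks N₁ 0 0 (Matrix.fromBlocks 0 0 (Matrix.of fun v _ => b₂ v) N₂) =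
              Matrix.fromBlocks (diagonal d₁ + N₁) 0 0
                (Matrix.fromBlocks (diagonal fun _ : Unit => (1 : MvPolynomial σ k)) 0
                  (Matrix.of fun v _ => b₂ v) (diagonal d₂ + N₂)) := by
            rw [← fromBlocks_diagonal, ← fromBlocks_diagonal, fromBlocks_add, fromBlocks_add]
            simp
          rw [hD, fromBlocks_mulVec, Sum.elim_comp_inl, Sum.elim_comp_inr, fromBlocks_mulVec,
            Sum.elim_comp_inl, Sum.elim_comp_inr]
          simp only [Matrix.mulVec_smul, hy₁, hy₂, Matrix.zero_mulVec, add_zero, zero_add,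
            smul_zero]
          congr 1
          congr 1
          · funext u
            simp [mulVec, dotProduct]
          · funext v
            simp [mulVec, dotProduct, Pi.smul_apply]
            ring
        · have hc₁C : (C c₁ : MvPolynomial σ k) * C (c₂ / c₁) = C c₂ := by
            rw [← C_mul, mul_div_cancel₀ _ hc10]
          have hu : ((fun _ : Unit => m₂) ⬝ᵥ fun _ => -C (c₂ / c₁)) = -(m₂ * C (c₂ / c₁)) := by
            simp [dotProduct]
          rw [sumElim_dotProduct_sumElim, sumElim_dotProduct_sumElim, dotProduct_smul,
            ArithExpr.eval, ← hv₁, ← hv₂, hu, smul_eq_mul]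
          linear_combination (m₂ - a₂ ⬝ᵥ y₂) * hc₁C
  | mul φ₁ φ₂ ih₁ ih₂ =>
    obtain ⟨V₁, _, _, d₁, N₁, a₁, b₁, m₁, c₁, hc₁, hd₁, hN₁0, hN₁, ha₁, hb₁, hm₁, hdet₁, y₁, hy₁,
      hv₁⟩ := ih₁
    obtain ⟨V₂, _, _, d₂, N₂, a₂, b₂, m₂, c₂, hc₂, hd₂, hN₂0, hN₂, ha₂, hb₂, hm₂, hdet₂, y₂, hy₂,
      hv₂⟩ := ih₂
    by_cases h₁ : φ₁.isConstInput = true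
    · -- `φ = c × φ₂`: free, constant `c c₂`
      obtain ⟨c, rfl⟩ := exists_eq_const_of_isConstInput h₁
      refine ⟨V₂, inferInstance, inferInstance, d₂, N₂, a₂, b₂, m₂, c * c₂, ?_, hd₂, hN₂0,
        fun u v => (hN₂ u v).imp (fun h => Or.inr h) id, fun v => (ha₂ v).imp (fun h => Or.inr h) id,
        fun v => (hb₂ v).imp (fun h => Or.inr h) id, hm₂.imp (fun h => Or.inr h) id, hdet₂,
        y₂, hy₂, ?_⟩
      · rw [ArithExpr.greenSize_const_mul]; exact hc₂
      · rw [C_mul, mul_assoc, hv₂]; rfl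
    by_cases h₂ : φ₂.isConstInput = true
    · -- `φ = φ₁ × c`: free, constant `c₁ c`
      obtain ⟨c, rfl⟩ := exists_eq_const_of_isConstInput h₂
      refine ⟨V₁, inferInstance, inferInstance, d₁, N₁, a₁, b₁, m₁, c₁ * c, ?_, hd₁, hN₁0,
        fun u v => (hN₁ u v).imp (fun h => Or.inl h) id, fun v => (ha₁ v).imp (fun h => Or.inl h) id,
        fun v => (hb₁ v).imp (fun h => Or.inl h) id, hm₁.imp (fun h => Or.inl h) id, hdet₁,
        y₁, hy₁, ?_⟩
      · rw [ArithExpr.greenSize_mul_const]; exact hc₁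
      · rw [C_mul, mul_comm (C c₁), mul_assoc, hv₁, mul_comm]; rfl
    -- non-constant factors: the product gadget of Thm. 2, constant `c₁ c₂`
    have h₁' : φ₁.isConstInput = false := by simpa using h₁
    have h₂' : φ₂.isConstInput = false := by simpa using h₂
    refine ⟨V₁ ⊕ (Unit ⊕ V₂), inferInstance, inferInstance,
      Sum.elim d₁ (Sum.elim (fun _ => -1) d₂),
      Matrix.fromBlocks N₁ (Matrix.of fun v j => Sum.elim (fun _ => b₁ v) (fun _ => 0) j) 0
        (Matrix.fromBlocks 0 (Matrix.of fun _ u => a₂ u) 0 N₂),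
      Sum.elim a₁ (Sum.elim (fun _ => m₁) 0),
      Sum.elim 0 (Sum.elim (fun _ => m₂) b₂), 0, c₁ * c₂, ?_, ?_, ?_, ?_, ?_, ?_, ?_, ?_, ?_⟩
    · rw [ArithExpr.greenSize_mul φ₁ φ₂ h₁' h₂']
      simp only [Fintype.card_sum, Fintype.card_unique]; omega
    · rintro (v | ⟨⟨⟩ | v⟩)
      · exact hd₁ v
      · exact Or.inr rfl
      · exact hd₂ v
    · rintro (v | ⟨⟨⟩ | v⟩)
      · exact hN₁0 v
      · rfl
      · exact hN₂0 v
    · rintro (u | ⟨⟨⟩ | u⟩) (v | ⟨⟨⟩ | v⟩)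
      · exact (hN₁ u v).imp (fun h => Or.inl h) id
      · exact (hb₁ u).imp (fun h => Or.inl h) id
      · exact Or.inr ⟨0, C_0.symm⟩
      · exact Or.inr ⟨0, C_0.symm⟩
      · exact Or.inr ⟨0, C_0.symm⟩
      · exact (ha₂ v).imp (fun h => Or.inr h) id
      · exact Or.inr ⟨0, C_0.symm⟩
      · exact Or.inr ⟨0, C_0.symm⟩
      · exact (hN₂ u v).imp (fun h => Or.inr h) id
    · rintro (v | ⟨⟨⟩ | v⟩)
      · exact (ha₁ v).imp (fun h => Or.inl h) id
      · exact hm₁.imp (fun h => Or.inl h) id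
      · exact Or.inr ⟨0, C_0.symm⟩
    · rintro (v | ⟨⟨⟩ | v⟩)
      · exact Or.inr ⟨0, C_0.symm⟩
      · exact hm₂.imp (fun h => Or.inr h) id
      · exact (hb₂ v).imp (fun h => Or.inr h) id
    · exact Or.inr ⟨0, C_0.symm⟩
    · have hD : diagonal (Sum.elim d₁ (Sum.elim (fun _ : Unit => (-1 : MvPolynomial σ k)) d₂)) +
          Matrix.fromBlocks N₁ (Matrix.of fun v j => Sum.elim (fun _ => b₁ v) (fun _ => 0) j) 0
            (Matrix.fromBlocks 0 (Matrix.of fun _ u => a₂ u) 0 N₂) =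
          Matrix.fromBlocks (diagonal d₁ + N₁)
            (Matrix.of fun v j => Sum.elim (fun _ => b₁ v) (fun _ => 0) j) 0
            (Matrix.fromBlocks (diagonal fun _ : Unit => (-1 : MvPolynomial σ k))
              (Matrix.of fun _ u => a₂ u) 0 (diagonal d₂ + N₂)) := by
        rw [← fromBlocks_diagonal, ← fromBlocks_diagonal, fromBlocks_add, fromBlocks_add]
        simp
      rw [hD, det_fromBlocks_zero₂₁, det_fromBlocks_zero₂₁, det_diagonal]
      simp only [Finset.univ_unique, Finset.prod_singleton]
      rcases hdet₁ with h1 | h1 <;> rcases hdet₂ with h2 | h2 <;> rw [h1, h2] <;> simp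
    · -- value: `y = ((m₂ − a₂·y₂) • y₁, −(m₂ − a₂·y₂), y₂)`
      refine ⟨Sum.elim ((m₂ - a₂ ⬝ᵥ y₂) • y₁) (Sum.elim (fun _ => -(m₂ - a₂ ⬝ᵥ y₂)) y₂), ?_, ?_⟩
      · have hD : diagonal (Sum.elim d₁ (Sum.elim (fun _ : Unit => (-1 : MvPolynomial σ k)) d₂)) +
            Matrix.fromBlocks N₁ (Matrix.of fun v j => Sum.elim (fun _ => b₁ v) (fun _ => 0) j) 0
              (Matrix.fromBlocks 0 (Matrix.of fun _ u => a₂ u) 0 N₂) =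
            Matrix.fromBlocks (diagonal d₁ + N₁)
              (Matrix.of fun v j => Sum.elim (fun _ => b₁ v) (fun _ => 0) j) 0
              (Matrix.fromBlocks (diagonal fun _ : Unit => (-1 : MvPolynomial σ k))
                (Matrix.of fun _ u => a₂ u) 0 (diagonal d₂ + N₂)) := by
          rw [← fromBlocks_diagonal, ← fromBlocks_diagonal, fromBlocks_add, fromBlocks_add]
          simp
        rw [hD, fromBlocks_mulVec, Sum.elim_comp_inl, Sum.elim_comp_inr, fromBlocks_mulVec,
          Sum.elim_comp_inl, Sum.elim_comp_inr, Matrix.mulVec_smul, hy₁, hy₂]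
        simp only [Matrix.zero_mulVec, zero_add]
        congr 1
        · funext v
          simp [mulVec, dotProduct, Fintype.sum_sum_type]
          ring
        · congr 1
          funext u
          simp [mulVec, dotProduct]
      · rw [sumElim_dotProduct_sumElim, sumElim_dotProduct_sumElim, dotProduct_smul,
          ArithExpr.eval, ← hv₁, ← hv₂, C_mul]
        simp [dotProduct]
        ring

end Thm3

end GKKP2011

/-! ### The named fact -/

open GKKP2011 in
/-- **GKKP 2011, Theorem 3 — PROVED**: over a field of characteristic `≠ 2`, every formula `φ` of
green size `e` is the determinant of a symmetric matrix of size exactly `2e + 3` whose entries are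
inputs of `φ` or constants of `k` (typed form of the statement file, entry-set erratum recorded
there). Discharges `GKKP2011_thm3`. [cite: GrenetEtAl2011, Thm 3] -/
theorem GKKP2011_thm3_holds : GKKP2011_thm3 := by
  intro k _ h2 σ φ
  classical
  obtain ⟨V, _, _, d, N, a, b, m, c₀, hc, hd, hN0, hN, ha, hb, hm, hdet, y, hy, hv⟩ :=
    Thm3.exists_signedABP φ
  -- pad with `r` isolated internal vertices (link `+1`, no arcs) up to `|V| + r = gsize(φ)`
  obtain ⟨r, hr⟩ : ∃ r, Fintype.card V + r = φ.greenSize := ⟨φ.greenSize - Fintype.card V, by omega⟩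
  set W : Type := V ⊕ Fin r
  set d' : W → MvPolynomial σ k := Sum.elim d (fun _ => 1) with hd'
  set N' : Matrix W W (MvPolynomial σ k) := Matrix.fromBlocks N 0 0 0 with hN'
  set a' : W → MvPolynomial σ k := Sum.elim a 0 with ha'
  set b' : W → MvPolynomial σ k := Sum.elim b 0 with hb'
  set T : Matrix W W (MvPolynomial σ k) := diagonal d' + N' with hT
  have hTblk : T = Matrix.fromBlocks (diagonal d + N) 0 0
      (diagonal fun _ : Fin r => (1 : MvPolynomial σ k)) := by
    rw [hT, hd', hN', ← fromBlocks_diagonal, fromBlocks_add]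
    simp
  have hdetT : T.det = 1 ∨ T.det = -1 := by
    rw [hTblk, det_fromBlocks_zero₂₁, det_diagonal]
    simp only [Finset.prod_const_one, mul_one]
    exact hdet
  have hdetsq : T.det ^ 2 = 1 := by
    rcases hdetT with h | h <;> rw [h] <;> norm_num
  have hunit : IsUnit T.det := by
    rcases hdetT with h | h <;> rw [h]
    · exact isUnit_one
    · exact isUnit_one.neg
  have hG : T * T⁻¹ = 1 := Matrix.mul_nonsing_inv T hunit
  have hG' : T⁻¹ * T = 1 := Matrix.nonsing_inv_mul T hunit
  have hy' : T *ᵥ Sum.elim y 0 = b' := by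
    rw [hTblk, fromBlocks_mulVec, Sum.elim_comp_inl, Sum.elim_comp_inr, hy, hb']
    simp
  have hyG : T⁻¹ *ᵥ b' = Sum.elim y 0 := by
    rw [← hy', Matrix.mulVec_mulVec, hG', Matrix.one_mulVec]
  have hval : a' ⬝ᵥ Sum.elim y 0 = a ⬝ᵥ y := by
    rw [ha', sumElim_dotProduct_sumElim, zero_dotProduct, add_zero]
  -- scalars
  set ε : MvPolynomial σ k := (-1) ^ Fintype.card W with hε
  set η : MvPolynomial σ k := C (c₀ * 2⁻¹ : k) with hη
  have hεsq : ε * ε = 1 := by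
    rw [hε, ← pow_add, ← two_mul, pow_mul, neg_one_sq, one_pow]
  have h2η : (2 : MvPolynomial σ k) * η = C c₀ := by
    rw [hη, show (2 : MvPolynomial σ k) = C 2 from (map_ofNat C 2).symm, ← C_mul,
      mul_comm c₀, ← mul_assoc, mul_inv_cancel₀ h2, one_mul]
  have hεc : ∃ c : k, ε = C c := by
    rcases neg_one_pow_eq_or (MvPolynomial σ k) (Fintype.card W) with h | h
    · exact ⟨1, by rw [hε, h, C_1]⟩
    · exact ⟨-1, by rw [hε, h, C_neg, C_1]⟩
  have h0c : ∃ c : k, (0 : MvPolynomial σ k) = C c := ⟨0, C_0.symm⟩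
  -- the symmetric matrix
  set S : Matrix (Fin 3 ⊕ (W ⊕ W)) (Fin 3 ⊕ (W ⊕ W)) (MvPolynomial σ k) :=
    Matrix.fromBlocks !![0, ε, η; ε, 0, m; η, m, 0] (borderBlock a' b') (borderBlock a' b')ᵀ
      (Matrix.fromBlocks 0 (diagonal d' + N'ᵀ) (diagonal d' + N') 0) with hS
  have hdetS : S.det = φ.eval := by
    rw [hS, Thm2.det_symD d' N' T⁻¹ hG hdetsq a' b' ε η m, abpValue, hyG, hval, ← hv]
    calc (-1) ^ Fintype.card W * (2 * ε * η * (m - a ⬝ᵥ y))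
        = ε * (ε * (2 * η) * (m - a ⬝ᵥ y)) := by rw [hε]; ring
      _ = C c₀ * (m - a ⬝ᵥ y) := by rw [h2η, ← mul_assoc, ← mul_assoc, hεsq, one_mul]
  have hSsym : S.IsSymm := by
    rw [hS]
    refine Matrix.IsSymm.fromBlocks ?_ rfl ?_
    · refine Matrix.IsSymm.ext fun i j => ?_
      fin_cases i <;> fin_cases j <;> rfl
    · refine Matrix.IsSymm.fromBlocks (by simp [Matrix.IsSymm]) ?_ (by simp [Matrix.IsSymm])
      rw [transpose_add, diagonal_transpose, transpose_transpose]
  -- entries of the padded data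
  have hd'' : ∀ w, d' w = 1 ∨ d' w = -1 := by
    rintro (v | j)
    · exact hd v
    · exact Or.inl rfl
  have hN'0 : ∀ w, N' w w = 0 := by
    rintro (v | j)
    · exact hN0 v
    · rfl
  have hN'' : ∀ u w, φ.IsInput (N' u w) ∨ ∃ c : k, N' u w = C c := by
    rintro (u | u) (w | w)
    · exact hN u w
    · exact Or.inr h0c
    · exact Or.inr h0c
    · exact Or.inr h0c
  have ha'' : ∀ w, φ.IsInput (a' w) ∨ ∃ c : k, a' w = C c := by
    rintro (v | j)
    · exact ha v
    · exact Or.inr h0c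
  have hb'' : ∀ w, φ.IsInput (b' w) ∨ ∃ c : k, b' w = C c := by
    rintro (v | j)
    · exact hb v
    · exact Or.inr h0c
  -- reindex to `Fin (2e + 3)`
  have hcard : Fintype.card (Fin 3 ⊕ (W ⊕ W)) = 2 * φ.greenSize + 3 := by
    simp only [Fintype.card_sum, Fintype.card_fin, W, ← hr]
    ring
  let e := Fintype.equivFinOfCardEq hcard
  refine ⟨Matrix.reindex e e S, hSsym.submatrix _, ?_, ?_⟩
  · intro i j
    rw [Matrix.reindex_apply, Matrix.submatrix_apply, hS]
    rcases e.symm i with p | (p | p) <;> rcases e.symm j with q | (q | q)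
    · rw [Matrix.fromBlocks_apply₁₁]
      fin_cases p <;> fin_cases q <;>
        first
        | exact Or.inr h0c
        | exact Or.inr hεc
        | exact Or.inr ⟨_, hη⟩
        | exact hm
    · rw [Matrix.fromBlocks_apply₁₂]
      fin_cases p
      · exact Or.inr h0c
      · exact ha'' q
      · exact Or.inr h0c
    · rw [Matrix.fromBlocks_apply₁₂]
      fin_cases p
      · exact Or.inr h0c
      · exact Or.inr h0c
      · exact hb'' q
    · rw [Matrix.fromBlocks_apply₂₁, Matrix.transpose_apply]
      fin_cases q
      · exact Or.inr h0c
      · exact ha'' p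
      · exact Or.inr h0c
    · rw [Matrix.fromBlocks_apply₂₂, Matrix.fromBlocks_apply₁₁]
      exact Or.inr h0c
    · rw [Matrix.fromBlocks_apply₂₂, Matrix.fromBlocks_apply₁₂, Matrix.add_apply,
        Matrix.transpose_apply, diagonal_apply]
      by_cases hpq : p = q
      · subst hpq
        rw [if_pos rfl, hN'0, add_zero]
        rcases hd'' p with h | h
        · exact Or.inr ⟨1, by rw [h, C_1]⟩
        · exact Or.inr ⟨-1, by rw [h, C_neg, C_1]⟩
      · rw [if_neg hpq, zero_add]
        exact hN'' q p
    · rw [Matrix.fromBlocks_apply₂₁, Matrix.transpose_apply]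
      fin_cases q
      · exact Or.inr h0c
      · exact Or.inr h0c
      · exact hb'' p
    · rw [Matrix.fromBlocks_apply₂₂, Matrix.fromBlocks_apply₂₁, Matrix.add_apply, diagonal_apply]
      by_cases hpq : p = q
      · subst hpq
        rw [if_pos rfl, hN'0, add_zero]
        rcases hd'' p with h | h
        · exact Or.inr ⟨1, by rw [h, C_1]⟩
        · exact Or.inr ⟨-1, by rw [h, C_neg, C_1]⟩
      · rw [if_neg hpq, zero_add]
        exact hN'' p q
    · rw [Matrix.fromBlocks_apply₂₂, Matrix.fromBlocks_apply₂₂]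
      exact Or.inr h0c
  · rw [Matrix.det_reindex_self, hdetS]

/-! ### Tree-vocabulary corollaries -/

/-- **Thm. 3 in tree vocabulary, PROVED**: over a field of characteristic `≠ 2`, the value of a
formula of green size `e` has a SYMMETRIC affine determinantal representation (`HasSymmDetRepr`) of
size `2e + 3` (every entry — an input of `φ` or a constant — is an affine linear form).
[cite: GrenetEtAl2011, Thm 3] -/
theorem ArithExpr.hasSymmDetRepr_eval_greenSize (k : Type) [Field k] (h2 : (2 : k) ≠ 0) (σ : Type)
    (φ : ArithExpr k σ) : HasSymmDetRepr φ.eval (2 * φ.greenSize + 3) := by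
  obtain ⟨A, hsymm, hent, hdet⟩ := GKKP2011_thm3_holds k h2 σ φ
  refine ⟨A, hsymm, fun a b => ?_, hdet⟩
  rcases hent a b with h | ⟨c, hc⟩
  · exact h.totalDegree_le_one
  · rw [hc, totalDegree_C]
    exact Nat.zero_le _

/-- **`sdc` of a formula, green-size form**: over a field of characteristic `≠ 2`,
`sdc(φ) ≤ 2·gsize(φ) + 3` (sharper than the skinny-size bound `2·size(φ) + 3` of Thm. 2, since
`gsize ≤ size`, `ArithExpr.greenSize_le_size`). [cite: GrenetEtAl2011, Thm 3] -/
theorem ArithExpr.symmDeterminantalComplexity_eval_le_greenSize (k : Type) [Field k]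
    (h2 : (2 : k) ≠ 0) (σ : Type) (φ : ArithExpr k σ) :
    symmDeterminantalComplexity φ.eval ≤ 2 * φ.greenSize + 3 :=
  symmDeterminantalComplexity_le (ArithExpr.hasSymmDetRepr_eval_greenSize k h2 σ φ)

end Literature.Computability.AlgebraicComplexity

end
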